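import Literature.AlgebraicGeometry.RealAlgebraic.PlaneCurveLocalCharts
import HarnessLib

/-!
# The upper half-sheet at a real crossing and the side sign (Rokhlin, layers 4–5 junction)

Sibling proof file of `ComplexOrientationFormula.lean` (topic
`Literature/AlgebraicGeometry/RealAlgebraic`). Everything here is PROVED; no definition and no
named fact is introduced.

Let `p ∈ ℚ[x, y]`, a direction `c`, and a holomorphic sheet `ξ ↦ (ξ + c y(ξ), y(ξ))` of the
complex curve `{p = 0}` through a REAL point `v = (x + c y(x), y(x))` (`y(x) ∈ ℝ`) at which the
line `ℓ(y) = (x + cy, y)` is transversal: `m = ⟪∇p(v), (c, 1)⟫ ≠ 0`. Moving off the real axis to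
`ξ = x + it`, `t > 0` small, the sheet point `w(t)` is non-real and

  `⟪Im w(t), J∇p(v)⟫ = -(|∇p(v)|²/m) t + o(t)`   (`isLittleO_imPairing_halfSheet`),

so its sign is `-sign(m)` (`eventually_mul_imPairing_neg`): first-order expansion of `p` at `v`
along the sheet (`p(w(t)) = 0`, `Dp(v)` real). Consequently, if the half `H` has side sign
`halfSideSign p H v = ±1` (Rokhlin: `H` consists near `v` of the non-real points with
`⟪Im w, J∇p(v)⟫ > 0`, resp. `< 0`), then the upper half-sheet lies in `H` iff
`halfSideSign p H v · m < 0` (`upper_halfSheet_mem_iff`). This converts the complex-side signs of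
the fibre sums into the real-side data `sign(m)`, `halfSideSign` entering
`complexOrientationSign = halfSideSign · gradOutwardSign`. [folklore]

## References

* V. A. Rokhlin, Complex orientations of real algebraic curves, Funct. Anal. Appl. 8 (1974)
  331–334, §2. [Rokhlin1974]
-/

noncomputable section

open MvPolynomial Set Filter Metric Asymptotics
open scoped _root_.Topology

namespace Literature.AlgebraicGeometry.RealAlgebraic

namespace Sheets

/-! ### Unfolding `halfSideSign = ±1` -/

/-- `halfSideSign p H v = 1` means: near `v` in the non-real locus, `H` is `{⟪Im w, J∇p(v)⟫ > 0}`.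
[folklore] -/
theorem eventually_mem_iff_pos_of_halfSideSign_eq_one {R : Type*} [CommSemiring R] [Algebra R ℂ]
    (p : MvPolynomial (Fin 2) R) {H : Set (Fin 2 → ℂ)} {v : Fin 2 → ℝ}
    (h : halfSideSign p H v = 1) :
    ∀ᶠ w in 𝓝[nonRealLocus p] (fun j => (v j : ℂ)), w ∈ H ↔ 0 < imPairing (posTangent p v) w := by
  classical
  unfold halfSideSign at h
  by_contra hc
  rw [if_neg hc] at h
  split_ifs at h <;> norm_num at h

/-- `halfSideSign p H v = -1` means: near `v` in the non-real locus, `H` is `{⟪Im w, J∇p(v)⟫ < 0}`.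
[folklore] -/
theorem eventually_mem_iff_neg_of_halfSideSign_eq_neg_one {R : Type*} [CommSemiring R] [Algebra R ℂ]
    (p : MvPolynomial (Fin 2) R) {H : Set (Fin 2 → ℂ)} {v : Fin 2 → ℝ}
    (h : halfSideSign p H v = -1) :
    ∀ᶠ w in 𝓝[nonRealLocus p] (fun j => (v j : ℂ)), w ∈ H ↔ imPairing (posTangent p v) w < 0 := by
  classical
  unfold halfSideSign at h
  by_contra hc
  rw [if_neg hc] at h
  split_ifs at h <;> norm_num at h

/-! ### The pairing along the upper half-sheet -/

variable (p : MvPolynomial (Fin 2) ℚ)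

/-- **First-order expansion along the half-sheet.** With `v = (x + c y(x), y(x))` real,
`g = ∇p(v)`, `m = g₀ c + g₁ ≠ 0` and `w(t) = (x + it + c y(x + it), y(x + it))`:
`m · ⟪Im w(t), J∇p(v)⟫ + |g|² t = o(t)` as `t → 0⁺`. [folklore] -/
theorem isLittleO_imPairing_halfSheet (c x : ℝ) {y : ℂ → ℂ} (hyd : DifferentiableAt ℂ y x)
    (hyreal : (y x).im = 0)
    (hroot : ∀ᶠ ξ in 𝓝 (x : ℂ), aeval (![ξ + (c : ℂ) * y ξ, y ξ] : Fin 2 → ℂ) p = 0) :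
    (fun t : ℝ =>
      (realGrad p ![x + c * (y x).re, (y x).re] 0 * c + realGrad p ![x + c * (y x).re, (y x).re] 1) *
        imPairing (posTangent p ![x + c * (y x).re, (y x).re])
          (![((x : ℂ) + (t : ℂ) * Complex.I) + (c : ℂ) * y ((x : ℂ) + (t : ℂ) * Complex.I),
            y ((x : ℂ) + (t : ℂ) * Complex.I)] : Fin 2 → ℂ) +
      (realGrad p ![x + c * (y x).re, (y x).re] 0 ^ 2 + realGrad p ![x + c * (y x).re, (y x).re] 1 ^ 2) * t)
      =o[𝓝[>] (0 : ℝ)] fun t : ℝ => t := by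
  set v : Fin 2 → ℝ := ![x + c * (y x).re, (y x).re] with hv
  set g₀ : ℝ := realGrad p v 0 with hg₀
  set g₁ : ℝ := realGrad p v 1 with hg₁
  set vC : Fin 2 → ℂ := fun j => (v j : ℂ) with hvC
  have hyx : y x = ((y x).re : ℂ) := Complex.ext (by simp) (by simp [hyreal])
  have hvC' : vC = ![(x : ℂ) + (c : ℂ) * y x, y x] := by
    funext j
    fin_cases j
    · show ((v 0 : ℝ) : ℂ) = (x : ℂ) + (c : ℂ) * y x
      rw [hv, Matrix.cons_val_zero]
      push_cast
      rw [← hyx]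
    · show ((v 1 : ℝ) : ℂ) = y x
      rw [hv, Matrix.cons_val_one, Matrix.cons_val_zero, ← hyx]
  set ξ : ℝ → ℂ := fun t => (x : ℂ) + (t : ℂ) * Complex.I with hξ
  set w : ℝ → Fin 2 → ℂ := fun t => ![ξ t + (c : ℂ) * y (ξ t), y (ξ t)] with hw
  set Δ : ℝ → ℂ := fun t => y (ξ t) - y x with hΔ
  -- `ξ t → x` and `Δ = O(t)`
  have hξc : Continuous ξ := by fun_prop
  have hξ0 : ξ 0 = x := by simp [hξ]
  have hξt : Tendsto ξ (𝓝[>] 0) (𝓝 (x : ℂ)) := by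
    have := hξc.tendsto 0
    rw [hξ0] at this
    exact this.mono_left nhdsWithin_le_nhds
  have hξsub : ∀ t, ξ t - x = (t : ℂ) * Complex.I := fun t => by simp [hξ]
  have hΔO : Δ =O[𝓝[>] 0] fun t : ℝ => t := by
    have h1 := (hyd.hasFDerivAt.isBigO_sub).comp_tendsto hξt
    refine h1.trans ?_
    refine (isBigO_of_le _ fun t => ?_)
    simp only [Function.comp_apply, hξsub, norm_mul, Complex.norm_I, mul_one, Complex.norm_real]
    exact le_rfl
  -- the derivative of `p` at `vC`
  set pC : MvPolynomial (Fin 2) ℂ := map (algebraMap ℚ ℂ) p with hpC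
  have hP := Literature.NumberTheory.Transcendental.hasFDerivAt_eval pC vC
  have hgrad : ∀ i, eval vC (pderiv i pC) = (realGrad p v i : ℂ) := by
    intro i
    rw [hpC, pderiv_map, ← aeval_eq_eval_mapC, hvC, aeval_ofReal, realGrad_apply]
  -- `w t → vC`
  have hyc : ContinuousAt y x := hyd.continuousAt
  have hwt : Tendsto w (𝓝[>] 0) (𝓝 vC) := by
    rw [hvC']
    have hyξ : Tendsto (fun t => y (ξ t)) (𝓝[>] 0) (𝓝 (y x)) := hyc.tendsto.comp hξt
    refine tendsto_pi_nhds.2 fun j => ?_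
    fin_cases j
    · exact (hξt.add (tendsto_const_nhds.mul hyξ))
    · exact hyξ
  -- the first-order expansion along `w`
  have hwsub : ∀ t, w t - vC = ![(t : ℂ) * Complex.I + (c : ℂ) * Δ t, Δ t] := by
    intro t
    rw [hvC']
    funext j
    fin_cases j
    · simp [hw, hΔ, hξ]
      ring
    · simp [hw, hΔ]
  have hwO : (fun t => w t - vC) =O[𝓝[>] 0] fun t : ℝ => t := by
    simp_rw [hwsub]
    refine isBigO_pi.2 fun j => ?_
    fin_cases j
    · show (fun t : ℝ => (t : ℂ) * Complex.I + (c : ℂ) * Δ t) =O[𝓝[>] (0 : ℝ)] fun t : ℝ => t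
      refine IsBigO.add ?_ (hΔO.const_mul_left _)
      refine isBigO_of_le _ fun t => ?_
      simp
    · show (fun t : ℝ => Δ t) =O[𝓝[>] (0 : ℝ)] fun t : ℝ => t
      exact hΔO
  have ho := (hP.isLittleO.comp_tendsto hwt).trans_isBigO hwO
  -- values of `p`
  have hzero : ∀ᶠ t in 𝓝[>] (0 : ℝ), eval (w t) pC = 0 := by
    filter_upwards [hξt.eventually hroot] with t ht
    rw [hpC, ← aeval_eq_eval_mapC]
    exact ht
  have hvzero : eval vC pC = 0 := by
    rw [hpC, ← aeval_eq_eval_mapC, hvC']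
    exact hroot.self_of_nhds
  have happ : ∀ z : Fin 2 → ℂ,
      (∑ i, eval vC (pderiv i pC) • (ContinuousLinearMap.proj i : (Fin 2 → ℂ) →L[ℂ] ℂ)) z =
        ∑ i, eval vC (pderiv i pC) * z i := fun z => by
    simp
  have hD : ∀ t, (∑ i, eval vC (pderiv i pC) • (ContinuousLinearMap.proj i : (Fin 2 → ℂ) →L[ℂ] ℂ))
      (w t - vC) = ((g₀ * c + g₁ : ℝ) : ℂ) * Δ t + (g₀ : ℂ) * ((t : ℂ) * Complex.I) := by
    intro t
    rw [happ, Fin.sum_univ_two, hgrad, hgrad, hwsub]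
    simp only [Matrix.cons_val_zero, Matrix.cons_val_one, ← hg₀, ← hg₁]
    push_cast
    ring
  have ho2 : (fun t : ℝ => ((g₀ * c + g₁ : ℝ) : ℂ) * Δ t + (g₀ : ℂ) * ((t : ℂ) * Complex.I))
      =o[𝓝[>] (0 : ℝ)] fun t : ℝ => t := by
    refine (ho.neg_left.congr' ?_ EventuallyEq.rfl)
    filter_upwards [hzero] with t ht
    show -((eval (w t) pC - eval vC pC -
      (∑ i, eval vC (pderiv i pC) • (ContinuousLinearMap.proj i : (Fin 2 → ℂ) →L[ℂ] ℂ)) (w t - vC))) = _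
    rw [ht, hvzero, hD]
    ring
  -- imaginary parts
  have ho3 : (fun t : ℝ => (g₀ * c + g₁) * (Δ t).im + g₀ * t) =o[𝓝[>] (0 : ℝ)] fun t : ℝ => t := by
    have h1 := (Complex.imCLM.isBigO_comp
      (fun t : ℝ => ((g₀ * c + g₁ : ℝ) : ℂ) * Δ t + (g₀ : ℂ) * ((t : ℂ) * Complex.I)) (𝓝[>] (0 : ℝ)))
    have h2 := h1.trans_isLittleO ho2
    refine h2.congr' (Eventually.of_forall fun t => ?_) EventuallyEq.rfl
    simp
  -- the pairing
  have himP : ∀ t, imPairing (posTangent p v) (w t) = -g₁ * t + (g₀ - c * g₁) * (Δ t).im := by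
    intro t
    have h1 : (y ((x : ℂ) + (t : ℂ) * Complex.I)).im = (Δ t).im := by simp [hΔ, hξ, hyreal]
    simp only [imPairing, posTangent, hw, Matrix.cons_val_zero, Matrix.cons_val_one]
    simp [hξ, hg₀, hg₁, h1]
    ring
  have ho4 := ho3.const_mul_left (g₀ - c * g₁)
  change (fun t : ℝ => (g₀ * c + g₁) * imPairing (posTangent p v) (w t) + (g₀ ^ 2 + g₁ ^ 2) * t)
    =o[𝓝[>] (0 : ℝ)] fun t : ℝ => t
  refine ho4.congr' (Eventually.of_forall fun t => ?_) EventuallyEq.rfl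
  show (g₀ - c * g₁) * ((g₀ * c + g₁) * (Δ t).im + g₀ * t) =
    (g₀ * c + g₁) * imPairing (posTangent p v) (w t) + (g₀ ^ 2 + g₁ ^ 2) * t
  rw [himP]
  ring

/-- **The sign of the pairing on the upper half-sheet is `-sign(m)`.** [folklore] -/
theorem eventually_mul_imPairing_neg (c x : ℝ) {y : ℂ → ℂ} (hyd : DifferentiableAt ℂ y x)
    (hyreal : (y x).im = 0)
    (hroot : ∀ᶠ ξ in 𝓝 (x : ℂ), aeval (![ξ + (c : ℂ) * y ξ, y ξ] : Fin 2 → ℂ) p = 0)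
    (hm : realGrad p ![x + c * (y x).re, (y x).re] 0 * c + realGrad p ![x + c * (y x).re, (y x).re] 1 ≠ 0) :
    ∀ᶠ t : ℝ in 𝓝[>] 0,
      (realGrad p ![x + c * (y x).re, (y x).re] 0 * c + realGrad p ![x + c * (y x).re, (y x).re] 1) *
        imPairing (posTangent p ![x + c * (y x).re, (y x).re])
          (![((x : ℂ) + (t : ℂ) * Complex.I) + (c : ℂ) * y ((x : ℂ) + (t : ℂ) * Complex.I),
            y ((x : ℂ) + (t : ℂ) * Complex.I)] : Fin 2 → ℂ) < 0 := by
  set g₀ : ℝ := realGrad p ![x + c * (y x).re, (y x).re] 0 with hg₀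
  set g₁ : ℝ := realGrad p ![x + c * (y x).re, (y x).re] 1 with hg₁
  have hG : 0 < g₀ ^ 2 + g₁ ^ 2 := by
    by_contra h
    have h0 : g₀ = 0 := by nlinarith [sq_nonneg g₀, sq_nonneg g₁]
    have h1 : g₁ = 0 := by nlinarith [sq_nonneg g₀, sq_nonneg g₁]
    exact hm (by rw [h0, h1]; ring)
  have h := (isLittleO_imPairing_halfSheet p c x hyd hyreal hroot).def (half_pos hG)
  filter_upwards [h, self_mem_nhdsWithin] with t ht ht0
  rw [mem_Ioi] at ht0
  rw [Real.norm_eq_abs, Real.norm_eq_abs, abs_of_pos ht0] at ht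
  have := (abs_le.1 ht).2
  nlinarith

/-! ### Which half contains the upper half-sheet -/

/-- **The upper half-sheet lies in `H` iff `halfSideSign · m < 0`.** Let the sheet through the
real point `v` be as above, with `halfSideSign p H v = ±1`, and let the points `w(t)` (`t > 0`
small) be non-real. Then `w(t) ∈ H` for all small `t > 0` iff `halfSideSign p H v · m < 0`, and
`w(t) ∉ H` for all small `t > 0` otherwise. [cite: Rokhlin1974, §2] -/
theorem upper_halfSheet_mem_iff (c x : ℝ) {y : ℂ → ℂ} (hyd : DifferentiableAt ℂ y x)
    (hyreal : (y x).im = 0)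
    (hroot : ∀ᶠ ξ in 𝓝 (x : ℂ), aeval (![ξ + (c : ℂ) * y ξ, y ξ] : Fin 2 → ℂ) p = 0)
    (hm : realGrad p ![x + c * (y x).re, (y x).re] 0 * c + realGrad p ![x + c * (y x).re, (y x).re] 1 ≠ 0)
    {H : Set (Fin 2 → ℂ)}
    (hhs : halfSideSign p H ![x + c * (y x).re, (y x).re] = 1 ∨
      halfSideSign p H ![x + c * (y x).re, (y x).re] = -1)
    (hN : ∀ᶠ t : ℝ in 𝓝[>] 0,
      (![((x : ℂ) + (t : ℂ) * Complex.I) + (c : ℂ) * y ((x : ℂ) + (t : ℂ) * Complex.I),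
        y ((x : ℂ) + (t : ℂ) * Complex.I)] : Fin 2 → ℂ) ∈ nonRealLocus p) :
    (∀ᶠ t : ℝ in 𝓝[>] 0,
      (![((x : ℂ) + (t : ℂ) * Complex.I) + (c : ℂ) * y ((x : ℂ) + (t : ℂ) * Complex.I),
        y ((x : ℂ) + (t : ℂ) * Complex.I)] : Fin 2 → ℂ) ∈ H ↔
      (halfSideSign p H ![x + c * (y x).re, (y x).re] : ℝ) *
        (realGrad p ![x + c * (y x).re, (y x).re] 0 * c +
          realGrad p ![x + c * (y x).re, (y x).re] 1) < 0) := by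
  have hsign := eventually_mul_imPairing_neg p c x hyd hyreal hroot hm
  obtain ⟨v, hv⟩ : ∃ v : Fin 2 → ℝ, v = ![x + c * (y x).re, (y x).re] := ⟨_, rfl⟩
  rw [← hv] at hhs hm hsign ⊢
  obtain ⟨w, hw⟩ : ∃ w : ℝ → Fin 2 → ℂ, ∀ t, w t =
      (![((x : ℂ) + (t : ℂ) * Complex.I) + (c : ℂ) * y ((x : ℂ) + (t : ℂ) * Complex.I),
        y ((x : ℂ) + (t : ℂ) * Complex.I)] : Fin 2 → ℂ) := ⟨_, fun _ => rfl⟩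
  simp only [← hw] at hN hsign ⊢
  -- `w t → v` within the non-real locus
  have hyx : y x = ((y x).re : ℂ) := Complex.ext (by simp) (by simp [hyreal])
  have hvC : (fun j => (v j : ℂ)) = ![(x : ℂ) + (c : ℂ) * y x, y x] := by
    funext j
    fin_cases j
    · show ((v 0 : ℝ) : ℂ) = (x : ℂ) + (c : ℂ) * y x
      rw [hv, Matrix.cons_val_zero]
      push_cast
      rw [← hyx]
    · show ((v 1 : ℝ) : ℂ) = y x
      rw [hv, Matrix.cons_val_one, Matrix.cons_val_zero, ← hyx]
  have hξt : Tendsto (fun t : ℝ => (x : ℂ) + (t : ℂ) * Complex.I) (𝓝[>] 0) (𝓝 (x : ℂ)) := by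
    have hc : Continuous fun t : ℝ => (x : ℂ) + (t : ℂ) * Complex.I := by fun_prop
    have := hc.tendsto 0
    simp only [Complex.ofReal_zero, zero_mul, add_zero] at this
    exact this.mono_left nhdsWithin_le_nhds
  have hwt : Tendsto w (𝓝[>] 0) (𝓝 (fun j => (v j : ℂ))) := by
    rw [hvC, show w = fun t : ℝ => (![((x : ℂ) + (t : ℂ) * Complex.I) + (c : ℂ) *
      y ((x : ℂ) + (t : ℂ) * Complex.I), y ((x : ℂ) + (t : ℂ) * Complex.I)] : Fin 2 → ℂ) from
      funext hw]
    have hyξ : Tendsto (fun t : ℝ => y ((x : ℂ) + (t : ℂ) * Complex.I)) (𝓝[>] 0) (𝓝 (y x)) :=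
      hyd.continuousAt.tendsto.comp hξt
    refine tendsto_pi_nhds.2 fun j => ?_
    fin_cases j
    · exact (hξt.add (tendsto_const_nhds.mul hyξ))
    · exact hyξ
  have hwtN : Tendsto w (𝓝[>] 0) (𝓝[nonRealLocus p] (fun j => (v j : ℂ))) :=
    tendsto_nhdsWithin_iff.2 ⟨hwt, hN⟩
  rcases hhs with h1 | h1
  · have hev := hwtN.eventually (eventually_mem_iff_pos_of_halfSideSign_eq_one p h1)
    filter_upwards [hev, hsign] with t ht hs
    rw [h1, ht]
    push_cast
    rw [one_mul]
    constructor
    · intro hpos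
      nlinarith
    · intro hneg
      nlinarith
  · have hev := hwtN.eventually (eventually_mem_iff_neg_of_halfSideSign_eq_neg_one p h1)
    filter_upwards [hev, hsign] with t ht hs
    rw [h1, ht]
    push_cast
    constructor
    · intro hneg
      nlinarith
    · intro hpos
      nlinarith

end Sheets

end Literature.AlgebraicGeometry.RealAlgebraic
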